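import Mathlib
import HarnessLib
import HarnessLib.Audit
import Summits.Langlands.Statement
import Literature.NumberTheory.GaloisRepresentations.OrdinaryGaloisRep
import Literature.NumberTheory.Automorphic.ArchRankinSelbergTestVector
import Literature.NumberTheory.Automorphic.ArchRankinSelbergGapTestVector
import HarnessLib.Audit.Status.Attr

/-!
Route: FifteenLocusEisenstein

# Route FifteenLocusEisenstein — every elliptic curve over every imaginary quadratic field — the
X₀(15) locus is Eisenstein at 5, split by its local 5-adic shape

RECOMBINATION LENS (cycle 2). It suffices to show X = Target: for every imaginary quadratic field F
(IsTotallyComplex ∧ finrank 2) and every elliptic curve E/F without geometric CM, given by an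
integral Weierstrass model over 𝓞_F with Δ ≠ 0 (Mathlib `WeierstrassCurve (𝓞 F)`; tree `HasCM` on
`E.baseChange F`), for every level witness hcpt there is an L-algebraic cuspidal π on GL₂(𝔸_F) whose
Satake parameters match the POINT COUNTS of E at almost every place — Σα⁻¹ = a_w(E) = N w + 1 −
#E(k_w) (tree `frobTraceAt`), Πα⁻¹ = N w — the lang.S28 / FiveIsogenyEllipticCurves shape
(L-normalisation: the α⁻¹ are the arithmetic-Frobenius eigenvalues on V_ℓE by Hasse–Weil, so this is
the summit's `SatakeFrobCompatibleAt` for ρ_(E,ℓ) read through the tree's proved Euler-factor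
theorem; CONE REPAIR rev 3: no `framedTateGaloisRep` in the route file) — MODULARITY OF EVERY NON-CM
ELLIPTIC CURVE OVER EVERY IMAGINARY QUADRATIC FIELD, the weight-(0,1) slice of conjunct (B) for n =
2 over these fields. Caraiani–Newton (CaraianiNewton2023 Thm 7.1(1), input item
IrreducibleFiveModular) prove it whenever Γ_F acts irreducibly on E[5]; what is left is the
5-REDUCIBLE LOCUS X₀(5)(F) ⊃ X₀(15)(F) (infinite for every F; CN Thm 1.1 needs rk X₀(15)(F) = 0
exactly to dodge it), on which the mod-5 residue is EISENSTEIN FOR FREE, and the route splits it by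
the LOCAL 5-adic shape of ρ_(E,5): (i) nearly ordinary of weight 2 at every v ∣ 5 with a
Skinner–Wiles orientation ⇒ the imported engine ReducibleOrdinaryModular of route
SkinnerWilesDefectOne through the bookkeeping crux OrientedOrdinaryOfEngine (its banked corollary
FiveIsogenyEllipticCurves generalised from good-ordinary/uniform-type to the full oriented case);
(ii) nearly ordinary at every v ∣ 5 but NO orientation (the μ/étale type of the isogeny kernel
differs at the two places over a split 5 — intrinsic to the isogeny class) ⇒ NEW crux
UnorientedOrdinaryModular; (iii) NOT nearly ordinary at some v ∣ 5 (potentially supersingular: good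
supersingular at an inert 5, or additive potentially supersingular at any 5 — the shape of the four
conductor-50 points of X₀(15)(ℚ)) ⇒ NEW crux NonOrdinaryEisensteinModular. In the items ρ_(E,p) is
addressed only through its IRREDUCIBLE TATE FRAMES — ρ : Γ_F → GL₂(ℚ̄_p) irreducible, unramified
a.e., with Frobenius characteristic polynomial X² − a_w(E)X + N w at almost every w (exactly the
GL₂(ℚ̄_p)-conjugates of ρ_(E,p), by Hasse–Weil, Chebotarev–Brauer–Nesbitt and Serre–Faltings
irreducibility for non-CM E) — so the route file imports only the Statement and `OrdinaryGaloisRep`.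
X → Langlands is the declared residual SectorComplement. No card is realised (novel-route seat, lens
recomb); provenance per crux in § Cruxes.
Lean: `∀ (F : Type) [Field F] [NumberField F], NumberField.IsTotallyComplex F → Module.finrank ℚ F =
2 → ∀ (E : WeierstrassCurve (NumberField.RingOfIntegers F)), E.Δ ≠ 0 → ¬ (E.baseChange F).HasCM → ∀
(hcpt : Literature.NumberTheory.Automorphic.isCompact_glFiniteIntegralLevel 2 F), ∃ π :
Literature.NumberTheory.Automorphic.CuspidalAutomorphicRepData 2 F hcpt, π.1.IsLAlgebraic ∧ ∀ᶠ w :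
IsDedekindDomain.HeightOneSpectrum (NumberField.RingOfIntegers F) in Filter.cofinite, ∃ α : Multiset
ℂ, π.1.HasSatakeParamAt w α ∧ (α.map fun a => a⁻¹).sum =
(Literature.NumberTheory.Automorphic.frobTraceAt E w : ℂ) ∧ (α.map fun a => a⁻¹).prod =
(w.residueCard : ℂ)`

## Assembly
Pure logic (glue.lean = the deciding theorem `closes`, lean check rc 0, axioms propext /
Classical.choice / Quot.sound): SectorComplement reduces `Langlands` to Target; fix F, E, hcpt;
by_cases on `(E.baseChange F).HasIrreducibleModPGaloisRep 5` — true ⇒ IrreducibleFiveModular; false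
⇒ by_cases on 'some irreducible Tate frame at 5 is nearly ordinary of weight 2 at every v ∣ 5' (the
literal ∃-hypothesis of UnorientedOrdinaryModular, its negation the hypothesis of
NonOrdinaryEisensteinModular) — false ⇒ NonOrdinaryEisensteinModular at p = 5; true ⇒ by_cases on
the Skinner–Wiles datum (the literal ∃-block) — true ⇒ OrientedOrdinaryOfEngine fed with
ReducibleOrdinaryModular at p = 5; false ⇒ UnorientedOrdinaryModular at p = 5. Every crux is a
hypothesis of `closes` and every hypothesis is a crux.

Rationale: WHY THIS LINE. From route-Langlands-SkinnerWilesDefectOne: the ENGINE (Skinner–Wiles Thm A at defect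
one, imported verbatim as the shared item ReducibleOrdinaryModular) and the learning of its banked
corollary FiveIsogenyEllipticCurves and Negative files that SW needs ONE orientation (type 𝒟) at
every v ∣ p and good ordinary reduction — i.e. exactly which 15-isogeny curves it cannot reach; from
route-Langlands-EvenSkinnerWilesMirror (recomb cycle 1): the pattern 'import the SW engine into a
sector where residual reducibility is FORCED' — here forced by CN's 3–5 switching, which leaves
precisely the Borel-at-5 curves (CaraianiNewton2023 Thm 7.1, Lemma 7.1.1, Cor 7.1.2;
FreitasLeHungSiksek2015's 3–7 switch is unavailable over F because X_E(7) has genus 3 and residual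
modularity mod 7 over CM fields does not exist); from route-Langlands-NewtonPatching (support
EllipticAnySlopeCM): the calibration that the any-slope weight-0 elliptic face over CM fields is
ACC+/CN territory only for residually LARGE image; from route-Langlands-IrreducibilityBySelfDuality
(banked HalfIntegralTwistCM = Weil's unit criterion over a CM field): over an imaginary quadratic
field algebraic Hecke characters of infinity type (1,0) exist with any prescribed reduction, and
they ARE the reducible locus of the unoriented case (ii) — the CM-type Eisenstein pencil ψ ⊕ εψ'ψ⁻¹…
of parallel Hodge–Tate weight (0,1) that Hida's nearly-ordinary Eisenstein families (one orientation
at every v ∣ p) never see. The new lever of (iii): at FIXED (potentially Barsotti–Tate) weight over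
an imaginary quadratic field the type-𝒟 reducible locus is FINITE UNCONDITIONALLY — dim H¹_f(F,
ψ(1)) ≤ 1 (Dirichlet units of F(ψ)) and H¹_f(F, ψ(−1)) = 0 (Borel: rk K₃(𝓞_L) = r₂(L), regular as a
Galois module) — so the Λ-adic reducible strata that Skinner–Wiles fight by base change and
SkinnerWilesDefectOne fights with an auxiliary Taylor–Steinberg place collapse to points, and
Allen–Newton–Thorne's Schur deformation theory (Thorne2014, AllenNewtonThorne2020 =
arXiv:1912.11269: ordinary, unitary type, 'finite over Λ' bookkeeping) can be run at fixed weight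
with Kisin's potentially-Barsotti–Tate local rings (doi:10.4007/annals.2009.170.1085, any F_v)
inside Calegari–Geraghty two-term complexes (CalegariGeraghty2017; torsion determinants and
crystalline local–global compatibility from CaraianiNewton2023 Thm 4.2.15). Imported areas:
automorphy lifting at positive defect, Galois cohomology (Bloch–Kato Selmer dimensions from unit and
K₃ ranks), Hida/CM theory of imaginary quadratic fields, the arithmetic of the elliptic curve X₀(15)
= 15A1 (rank 0 over ℚ, so every F-point x satisfies xᶜ = −x + t, t ∈ X₀(15)(ℚ) ≅ ℤ/2 × ℤ/4). What no
parent had: SkinnerWilesDefectOne reaches only oriented ordinary ρ; CN only residually irreducible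
E[3] or E[5]; Berger–Klosin (arXiv:1606.06535, BergerKlosin2011) assume the finiteness this line
proves for type 𝒟; nobody has a NON-ordinary residually reducible engine away from F_v = ℚ_p
(Pan2022, arXiv:2411.18661 need the p-adic local correspondence).

RANKED CRUXES. #0 Target (target) — every elliptic curve without geometric CM over an imaginary
quadratic field F (integral Weierstrass model E over 𝓞_F, Δ ≠ 0, ¬(E.baseChange F).HasCM) is
modular: for all hcpt an L-algebraic cuspidal π on GL₂(𝔸_F) with Σα⁻¹ = a_w(E), Πα⁻¹ = N w at almost
every place (point-count form, verbatim the conclusion of the PROVED FiveIsogenyEllipticCurves).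
(why it might fail: False only if some non-CM E/F imaginary quadratic is not modular (nobody expects
it); as typed the risk is the Satake normalisation (α⁻¹ = arithmetic Frobenius eigenvalues on V_ℓE,
as in the banked FiveIsogenyEllipticCurves) — a q_v-slip makes it unprovable, not false-by-example.)
[CaraianiNewton2023, arXiv:2405.09337, FreitasLeHungSiksek2015, BuzzardGeeLMS2014]
#2 NonOrdinaryEisensteinModular (crux) — THE NEW LEVER (from route-Langlands-SkinnerWilesDefectOne:
its engine stops at ordinary; from Berger–Klosin: the finiteness hypothesis made unconditional). F
imaginary quadratic, p odd, E/F non-CM with E[p] reducible (an F-rational p-isogeny) and NOT nearly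
ordinary of weight 2 at some v ∣ p (no Borel frame with cyclotomic-times-finite sub on inertia:
potentially supersingular at v — good supersingular at an inert p, or additive potentially
supersingular as for the conductor-50 curves at p = 5; typed: NO irreducible Tate frame ρ of E at p
— irreducible, a.e. unramified, Frobenius charpoly X² − a_w(E)X + N w a.e. — is
`IsOrdinaryOfWeightAt p v 2 m` (m > 0) at every v ∣ p) ⇒ E modular (point-count form). Mechanism:
fixed-weight Schur-reducible potentially-Barsotti–Tate lifting at defect one — non-split residual
extension c ∈ H¹(F, χ'χ⁻¹) (Ribet lattice), Thorne/ANT μ₂²-action and trace subring P = R^ps-image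
étale at irreducible points, Kisin pot-BT local rings at every F_v, CG patched complexes in degrees
[1,2] (Bianchi: Eisenstein classes live in the same range once χ ∉ {1, ε̄}), reducible locus of the
fixed-weight ring = finitely many type-𝒟 points (h¹_f(ψ(1)) ≤ 1, h¹_f(ψ(−1)) = 0) plus CM-type
pencils of dimension h¹_f(anticyclotomic CM character) − 1, bounded on the patched side by
SkinnerWilesDefectOne's auxiliary Taylor–Steinberg place (banked
SteinbergHyperplane.tame_relation_pin). [difficulty: open-problem] (why it might fail: TW primes
cannot kill H¹(F,χ/χ') classes (local H¹ dies where ρ̄(Frob_q) has distinct eigenvalues):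
scalar-Frobenius primes AND CG patching at an Eisenstein 𝔪 (boundary classes, non-free complexes)
are needed at once; no non-ordinary residually reducible lifting is in print off F_v = ℚ_p.)
[Thorne2014, arXiv:1912.11269, arXiv:1606.06535, BergerKlosin2011, Pan2022, arXiv:2411.18661,
CalegariGeraghty2017, CaraianiNewton2023, doi:10.4007/annals.2009.170.1085]
#3 UnorientedOrdinaryModular (crux) — MIXED TYPE (from route-Langlands-SkinnerWilesDefectOne's
FiveIsogenyEllipticCurves: 'the mixed type at split 5 is outside Skinner–Wiles … deliberately
excluded'; from route-Langlands-IrreducibilityBySelfDuality's HalfIntegralTwistCM: CM-type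
characters exist). F imaginary quadratic, p odd, E/F non-CM with E[p] reducible, nearly ordinary of
weight 2 at EVERY v ∣ p (typed: some irreducible Tate frame of E at p is `IsOrdinaryOfWeightAt p v 2
m`, m > 0, at every v ∣ p), but admitting NO Skinner–Wiles datum (no irreducible Tate frame with
residually upper-triangular integral model over the valuation ring, p-distinguished and oriented
ordinary of weight 2 at every v ∣ p with one common m) ⇒ E modular (point-count form). Content (p ≥
5, where p-distinguishedness is automatic since e(F_v/ℚ_p) ≤ 2 < p − 1; at p = 3 the
non-distinguished curves over F with √−3 ∈ F_v also land here): p splits and the isogeny kernel is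
of multiplicative type at v₁ and étale at v₂ for EVERY curve of the isogeny class (the Verschiebung
swap), so the global residual sub is the local ordinary line at v₁ and the local quotient at v₂.
Mechanism: Skinner–Wiles propagation seeded not by Hida's Eisenstein family but by the CM-type
Eisenstein pencil ψ ⊕ εψ_detψ⁻¹ with ψ of infinity type (1,0) (Hodge–Tate 1 at v₁, 0 at v₂), which
is exactly the reducible locus of the mixed-oriented nearly-ordinary deformation ring and still has
parallel weight (0,1). [difficulty: open-problem] (why it might fail: The mixed-oriented reducible
pencil has dimension h¹_f of an anticyclotomic CM character (BSD-type, may exceed 1); near-ordinary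
automorphy of CM-type Eisenstein systems with the MIXED refinement in the Bianchi Hida/completed
Hecke algebra is unrecorded (Harder gives classes, not refinements).) [SkinnerWiles1999,
CaraianiNewton2023, Thorne2014, arXiv:1606.06535, CalegariGeraghty2017, Weil1956]
#4 ReducibleOrdinaryModular (crux) — IMPORTED ENGINE — verbatim the target X of route
SkinnerWilesDefectOne (stmt-Langlands-12918; provenance: from route-Langlands-SkinnerWilesDefectOne,
its whole mechanism: pro-modularity at defect one with the auxiliary Steinberg pin + ordinary
classicality; staffed THERE, re-asked here so that this route's uncertainty is exactly its crux
list): over an imaginary quadratic F, p ≠ 2, every irreducible a.e.-unramified ρ : Γ_F → GL₂(ℚ̄_p)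
with residually upper-triangular integral model, p-distinguished and SW-oriented ordinary of one
parallel weight k ≥ 2 at every v ∣ p, is weakly modular. [difficulty: open-problem] (why it might
fail: = Fontaine–Mazur (B) in the residually reducible, p-distinguished, SW-oriented ordinary
parallel-weight sector over imaginary quadratic F (defect one, no base change available); only
BergerKlosin2011/Akers-type minimal cases proved; typing audited ×3 on the parent route.)
[SkinnerWiles1999, BergerKlosin2011, CaraianiNewton2023, CalegariGeraghty2017]
#5 OrientedOrdinaryOfEngine (crux) — ENGINE ⇒ ORIENTED CASE (generalises the banked corollary
FiveIsogenyEllipticCurves of route SkinnerWilesDefectOne from 'good ordinary, uniform type, p = 5'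
to every non-CM E/F admitting a Skinner–Wiles datum at an odd p: an irreducible Tate frame ρ of E at
p — irreducible, a.e. unramified, Frobenius charpoly X² − a_w(E)X + N w a.e. — with residually
upper-triangular integral model ρ₀ over the valuation ring, p-distinguished and oriented ordinary of
weight 2 (one common m) at every v ∣ p) — given ReducibleOrdinaryModular, such E is modular in
point-count form: apply the engine to ρ with any ι : ℚ̄_p ≃ ℂ (irreducibility and
a.e.-unramifiedness are hypotheses of the datum), then read Σα⁻¹ = a_w, Πα⁻¹ = N w off
`SatakeFrobCompatibleAt ι π ρ w` and the frame's charpoly clause through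
`HasFrobCharpolyAt.unique_holds` and `arithFrobPolyOfSatake_one` (pure algebra; the banked
fiveIsogenyEllipticCurves_proof performed exactly this transport). [deps: ReducibleOrdinaryModular]
[difficulty: M] (why it might fail: Bookkeeping only after the retyping: the residual risks are an
L- /C-normalisation slip between SatakeFrobCompatibleAt and Σα⁻¹ = a_w, or charpoly uniqueness at the
finitely many exceptional w (absorbed by 'cofinite') — a restatement, not falsity.)
[SkinnerWiles1999, CaraianiNewton2023, SilvermanAEC2009, Serre1972]
#6 IrreducibleFiveModular (crux) — INPUT — Caraiani–Newton 2023, Theorem 7.1(1) (with Lemma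
6.1.3(2)): F imaginary quadratic, E/F with Γ_F acting irreducibly on E[5] (tree
`HasIrreducibleModPGaloisRep 5`) and no geometric CM (integral model E over 𝓞_F, Δ ≠ 0) ⇒ E modular:
for all hcpt an L-algebraic cuspidal π with Σα⁻¹ = a_w(E), Πα⁻¹ = N w a.e. (point-count form).
Printed theorem (3–5 switching over CM fields + crystalline torsion local–global compatibility +
quadratic points on X(ns3°,b5), X(b3,ns5), X(s3,ns5), X(ns3°,ns5)); formalization debt, filed as a
crux so that `closes` assumes cruxes only. [difficulty: XL] (why it might fail: Formalization debt,
not mathematics: printed CaraianiNewton2023 Thm 7.1(1) (+ Lemma 6.1.3: r_ι(π) ≅ r_(E,p)^∨ for all p,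
ι); false as typed only by a C- /L-normalisation slip in the Satake clause (checked against
FiveIsogenyEllipticCurves' Σα⁻¹ = a_w convention).) [CaraianiNewton2023,
AllenKhareThorne2021WeightOne, ACCGHLNSTT2023]
#9 SectorComplement (crux) — THE REST OF THE MOUNTAIN — `Target → Langlands`: every n ≠ 2, every F
not imaginary quadratic, direction (A), CM curves, weights other than (0,1), local–global
compatibility at every place, 𝓡 — the honestly-labelled residual of this sector route
(summit-strength modulo Target; closes only with the summit; not where this route directs provers; a
crux so that every hypothesis of `closes` is a declared crux). [difficulty: open-problem] (why it
might fail: It IS the open reciprocity conjecture for GL_n outside one sector (BuzzardGeeLMS2014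
Conj. 3.2.1/3.2.2, FontaineMazurGeometric1995 Conj. 1); no engine is claimed; implied by the summit
itself.) [BuzzardGeeLMS2014, FontaineMazurGeometric1995, Calegari2023]

TWO-LAYER PLAN. Foreseen glued splits once a crux closes (none filed now):
NonOrdinaryEisensteinModular ⇐ FixedWeightReducibleLocusFinite (h¹_f(F,ψ(1)) ≤ 1, h¹_f(F,ψ(−1)) = 0,
CM-pencil bound: Galois cohomology, provable) → SchurPotBTPatchingDefectOne (Thorne/ANT at fixed
weight in CG complexes) → NonOrdinaryEisensteinModular; UnorientedOrdinaryModular ⇐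
MixedEisensteinSeed (CM-type Eisenstein eigensystems are nearly-ordinarily automorphic with the
mixed refinement) → MixedOrientationPropagation (SW (I)–(III) from that seed) →
UnorientedOrdinaryModular; OrientedOrdinaryOfEngine is a single bookkeeping step after the retyping
(no ℓ ↔ p transfer left); the common first lemma of the NonOrdinaryEisensteinModular /
UnorientedOrdinaryModular provers — 'ρ_(E,p) = framedTateGaloisRep in any basis IS an irreducible
Tate frame' (Hasse–Weil: tree hasseWeilEulerFactor_of_hasGoodReduction_holds; irreducibility for
non-CM E: tree pattern isIrreducible_toGaloisRep_framedTate) — lives in Theorems files, which may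
import FramedTateGaloisRep freely, and rides with `--supports`, never as an item.

KILL CRITERIA. None of the six items is refutable in Lean short of a non-modular elliptic curve over
an imaginary quadratic field (each is implied by modularity of all E/F). The line DIES (close
exhausted, hand the population back to SkinnerWilesDefectOne) if (a) a prover census shows CG
patching at an Eisenstein maximal ideal of a Bianchi Hecke algebra is obstructed in degrees [1,2]
themselves (not only at the boundary), killing both new cruxes' mechanisms at once, or (b) the
fixed-weight finiteness is shown irrelevant because the PATCHED reducible locus at defect one has
codimension ≤ 1 regardless (then NonOrdinaryEisensteinModular has no lever beyond Berger–Klosin's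
hypotheses). ReducibleOrdinaryModular refuted-misstated on the parent route ⇒ re-import its repaired
form (REPAIR DUTY), no pivot of this route's own cruxes.

NOT DECOMPOSED YET. The curve-to-datum bookkeeping inside OrientedOrdinaryOfEngine (potentially
multiplicative / potentially ordinary frames, the common m = lcm of inertial orders ≤ 12,
p-distinguishedness automatic for e(F_v/ℚ_p) ≤ 2 < p − 1 at p = 5); the split of
NonOrdinaryEisensteinModular into Galois-cohomology finiteness + patching; the CM-Eisenstein seed of
UnorientedOrdinaryModular; the sub-case of E[p] SPLIT (two independent isogenies, X₀(25)-type: Schur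
fails for the split lattice, a Ribet lattice must be chosen per constituent); p = 3 with ζ₃ ∈ F. All
are layer-2 children (D-0019), filed only after a closure.

CHEAPEST FALSIFIER. For the lever of NonOrdinaryEisensteinModular: compute dim H¹_f(F, ψ(1)) and
H¹_f(F, ψ(−1)) for finite-order ψ over an imaginary quadratic F — if either can exceed 1 (resp. 0)
the 'finite type-𝒟 reducible locus at fixed weight' claim is dead and the crux falls back to
Berger–Klosin's conditional setting; by Dirichlet (unit rank of the totally complex F(ψ) is [F(ψ):F]
− 1, one copy of each non-trivial ψ) and Borel (rk K₃ = r₂ = [F(ψ):F], the regular representation)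
they are ≤ 1 and 0 — consistent (paper check, minutes). For the population: the conductor-50 curves
(15-isogeny, j = −25/2 etc., potentially supersingular at 5 with F_v = ℚ_5) show case (iii) is
inhabited even at split 5; a refuter can list F-points of X₀(15)(ℚ(√−d)), d ≡ 7, 13 mod 15 (rank ≥ 1
predicted, 3 and 5 inert) and read off the local shape at 5 of a non-torsion point's curve
(Magma/PARI, minutes) — if EVERY such curve were nearly ordinary and oriented, the two new cruxes
would be vacuous in practice (not false) and the route would reduce to the engine.

NUMBERS. X₀(15) = 15A1, X₀(15)(ℚ) ≅ ℤ/2 × ℤ/4 (4 cusps + 4 conductor-50 points), rank 0 over ℚ, rank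
0 over ℚ(√−d) for d = 1, 2, 3, 5 and for an infinite family (Evink arXiv:2405.09337; MN15), root
number −1 (rank ≥ 1 predicted) for square-free d ≡ 6, 7, 9, 10, 11, 13, 14 mod 15
(CaraianiNewton2023 §1, Dok05); 5 inert in ℚ(√−d) iff d ≡ ±2 mod 5; potentially-good inertial orders
at p = 5: e ∈ {1,2,3,4,6}; a potentially ordinary E/ℚ_5 has e ∣ 4 (the prime-to-5 inertia of ℚ_5^ab
has order 4); the four non-cuspidal points of X₀(15)(ℚ) (j = −25/2, −121945/32, …, conductor 50 =
2·5²) have v₅(j) > 0, j ≡ 0 mod 5: additive potentially supersingular at 5; defect l₀ = 1 for GL₂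
over an imaginary quadratic field (tree `Literature.Barriers.Langlands.defectGL 0 1 2`). Items at
open: 8 (target, assembly, 6 cruxes).

DEFINITION REQUESTS. None. CONE REPAIR (rev 3, route-repair seat 2026-08-16):
`WeierstrassCurve.framedTateGaloisRep`, `Summit.Langlands.IsConjugate` and `SatakeFrobCompatibleAt …
(W.framedTateGaloisRep ℓ)` were removed from every item — `framedTateGaloisRep` is defined through
`rationalTateGaloisRepOf` of HasseWeilAbelian.lean, whose import cone carries 14 unproved named
facts (Ogg–Saito conductor identities, an Euler-factor schema refuted for singular models, …) none
of which this route uses, and the cone guardrail kept the route unstaffed; the items now speak of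
integral models `E : WeierstrassCurve (𝓞 F)` (`E.Δ ≠ 0`, `(E.baseChange F).HasCM`, `(E.baseChange
F).HasIrreducibleModPGaloisRep p` — Isogeny/GaloisAction, inside the Statement cone), point counts
`Literature.NumberTheory.Automorphic.frobTraceAt` (ReciprocityGLn) and irreducible Tate frames `ρ :
FramedGaloisRep F (PadicAlgCl p) 2` (`IsUnramifiedAt`, `HasFrobCharpolyAt`, `IsOrdinaryOfWeightAt`,
`HasUpperTriangularIntegralModel`, `IsPDistinguishedAt` all exist); route imports = Statement +
`OrdinaryGaloisRep` only (⊂ the cone of the READY route SkinnerWilesDefectOne); lean check rc 0 on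
Sketch.lean (closes, targetOfCruxes_holds, assembly_holds; axioms propext / Classical.choice /
Quot.sound). Cite facts wanted later (not blocking): CaraianiNewton2023 Thm 7.1(1) as a Literature
named fact in the `IsTateAutomorphic`/`CuspidalAutomorphicRepData` dictionary.

Novelty: Searches (2026-08-16): `lit search --source arxiv` on "modularity elliptic curves imaginary
quadratic fields" (12: CaraianiNewton2023, arXiv:2405.09337 Evink 'Imaginary quadratic fields F with
X₀(15)(F) finite', arXiv:2203.00731, arXiv:0804.2302 …), "residually reducible automorphy lifting"
(1: arXiv:1912.11269), "Berger Klosin residually reducible" (5: arXiv:0801.0091, arXiv:1103.5100,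
arXiv:1810.07808, arXiv:1606.06535, arXiv:2203.09434), "Fontaine-Mazur residually reducible" (4:
arXiv:1901.07166 Pan, arXiv:2411.18661 and arXiv:2512.21249 X. Zhang, arXiv:1611.09315 Berger),
"modularity elliptic curves CM fields" (AllenKhareThorne2021WeightOne, arXiv:2203.00731); local
searchd/vsearch DOWN (connection reset, retried), OpenAlex/S2 rate-limited; `lit galaxy search
--star all` on "residually reducible" (7 books: Cornell–Silverman–Stevens, Delbourgo …; 4 pdfs:
arXiv:1804.06400 Wake–Wang-Erickson, arXiv:2403.19565 EGH), "X_0(15)" (6 books, 2 pdfs, none on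
imaginary quadratic points), "modularity of elliptic curves over imaginary quadratic fields" (1
thesis pdf, unrelated); read: CaraianiNewton2023 pp. 1–6, 87–94 (Thm 1.1, 6.1, 7.1, Lemma 7.1.1, Cor
7.1.2), FreitasLeHungSiksek2015 pp. 1–5, SkinnerWiles1999 pp. 5–7 (Theorem; 'ordinary … essential to
the methods of this paper'), arXiv:1606.06535 abstract, arXiv:1912.11269 pp. 1–3 (Thm 1.1: ordinary,
unitary type, locally Steinberg); tree: routes SkinnerWilesDefectOne (engine,
FiveIsogenyEllipticCurves, 9 Negative files), EvenSkinner  [refs: 2405.09337, 2203.00731, 0804.2302, 1912.11269, 0801.0091, 1103.5100, 1810.07808, 1606.06535, 2203.09434, 1901.07166, 2411.18661, 2512.21249, 1611.09315, 1804.06400, 2403.19565, 2301.10509, CaraianiNewton2023, FreitasLeHungSiksek2015, SkinnerWiles1999, Thorne2014, Pan2022]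

Barriers (technique_class: residually-reducible-lifting defect-one fixed-weight): - technique_class: residually-reducible-lifting defect-one fixed-weight
- Literature.Barriers.Langlands.ResiduallyReducibleBarrier: NOT evaded in class — the whole route
lives in residually reducible land; it stands on the barrier's own recorded exits (Mazur's Schur
condition k ≅ End(V̄) for NON-SPLIT ρ̄, Skinner–Wiles pseudo-deformation propagation, Thorne's
scalar-Frobenius Taylor–Wiles primes) and adds one quantitative fact the barrier's sources lack: at
fixed weight over an imaginary quadratic field the type-𝒟 reducible locus is finite, so 'the part
corresponding to reducible representations whose dimension grows with Σ' (Skinner–Wiles, quoted in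
the barrier file) does not grow.
- Literature.Barriers.Langlands.ResiduallyReducibleBarrierNarrow: same; the residual representations
used are non-split extensions (Ribet lattices), never the decomposable V̄ = W₁ ⊕ W₂ the narrow form
proves fatal; the split-E[p] sub-case is named in NOT DECOMPOSED YET.
- Literature.Barriers.Langlands.TaylorWilesNumericalCoincidence: APPLIES (defectGL 0 1 2 = 1 for GL₂
over an imaginary quadratic field); evaded as the parents do — Calegari–Geraghty two-term complexes
/ completed cohomology with torsion determinants (CalegariGeraghty2017, CaraianiNewton2023), no
single-degree patching; conceded that non-free patched complexes at an Eisenstein 𝔪 are the live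
risk of NonOrdinaryEisensteinModular.
- Literature.Barriers.Langlands.TaylorWilesNumericalCoincidenceNarrow: same; ρ_(E,p) over F is NOT
polari

History (route lifecycle, newest last):
- 2026-08-16T16:51:00Z · rev 1: restated SectorComplement (stmt-Langlands-2175) — rev 1 (hygiene, same session as open): SectorComplement restated with the Target antecedent INLINED verbatim (same meaning, definitionally equal in this file) — (planner-plan-lens-Langlands-recomb-v2-g2-0)
- 2026-08-16T17:12:31Z · rev 3: restated Target (stmt-Langlands-15859), NonOrdinaryEisensteinModular (stmt-Langlands-15860), UnorientedOrdinaryModular (stmt-Langlands-15861), OrientedOrdinaryOfEngine (stmt-Langlands-15862), IrreducibleFiveModular (stmt-Langlands-15863), SectorComplement (stmt-Langlands-15882) — rev 3 (route-repair, cone guardr (planner-rrepair-Langlands-FifteenLocusEisenste-f01edbd6-0)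
- 2026-08-25T07:17:53Z · DORMANT — reconciler: no traction for 7.5 d (last activity item-evidence-added at 2026-08-17T19:05:05Z); parked, not closed — `ledger route dormant route-Langlands-Fiftee (operator:999:266408)
- 2026-08-28T21:08:21Z · REACTIVATED — reconciler: reactivated — activity statement-checked at 2026-08-28T19:08:39Z after parking at 2026-08-25T07:17:53Z (operator:999:1704998)

sub-problem: Langlands · status: open · opened planner-plan-lens-Langlands-recomb-v2-g2-0 2026-08-16T16:49:55Z · rev 6 · ledger route-Langlands-FifteenLocusEisenstein
GENERATED by the gate from the ledger (D-0016/17). Provers cite these decls: `theorem foo : Summit.Langlands.Langlands.Theses.FifteenLocusEisenstein.<Decl> := …` in Summits/Langlands/Langlands/Theorems/<Name>.lean.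
-/

namespace Summit.Langlands.Langlands.Theses.FifteenLocusEisenstein

open scoped BigOperators Topology Manifold Classical MeasureTheory ProbabilityTheory Matrix InnerProductSpace ComplexConjugate ContinuousMap
open Filter Set Function TopologicalSpace MeasureTheory

attribute [summit_statement] _root_.Langlands

-- earlier Target (stmt-Langlands-15859, replaced 2026-08-16T17:12:31Z -> stmt-Langlands-16053): retired by None — ∀ (F : Type) [Field F] [NumberField F], NumberField.IsTotallyComplex F → Module.finrank ℚ F = 2 → ∀ (W : WeierstrassCurve F) [W.IsElliptic], ¬ W.HasCM → ∀ (hcpt : Literature.NumberTheory.Automorphic.isCompact_glFiniteIntegralLevel 2 F) (ℓ : ℕ) [Fact ℓ.Prime] (ι : PadicAlgCl ℓ ≃+* ℂ), ∃ π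
/-- item stmt-Langlands-16053 · target · rank 0 · open · by planner
why it might fail: False only if some non-CM E/F imaginary quadratic is not modular (nobody expects it); as typed the risk is the Satake normalisation (Σα⁻¹ = a_w, Πα⁻¹ = N w — the convention of the PROVED FiveIsogenyEllipticCurves) — a slip makes it unprovable, not false-by-example.
sources: CaraianiNewton2023, arXiv:2405.09337, FreitasLeHungSiksek2015, BuzzardGeeLMS2014, ACCGHLNSTT2023
[target] CONE REPAIR rev 3 (integral models + point counts; same mathematics). Every elliptic curve
over an imaginary quadratic field F (IsTotallyComplex ∧ finrank ℚ F = 2) given by an integral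
Weierstrass model E over 𝓞_F with Δ ≠ 0 and without geometric CM (¬(E.baseChange F).HasCM) is
modular: for every level witness hcpt an L-algebraic cuspidal π on GL₂(𝔸_F) with Σ_j α_j⁻¹ = a_w(E)
= frobTraceAt E w and Π_j α_j⁻¹ = N w at almost every w (point-count form, L-normalisation; verbatim
the conclusion shape of the PROVED SkinnerWilesDefectOne.FiveIsogenyEllipticCurves). Every E/F has
such a model (clear denominators); finitely many non-minimal or bad places are absorbed by
'cofinite'. -/
@[route_item "route-Langlands-FifteenLocusEisenstein"]
def Target : Prop :=
  ∀ (F : Type) [Field F] [NumberField F], NumberField.IsTotallyComplex F → Module.finrank ℚ F = 2 → ∀ (E : WeierstrassCurve (NumberField.RingOfIntegers F)), E.Δ ≠ 0 → ¬ (E.baseChange F).HasCM → ∀ (hcpt : Literature.NumberTheory.Automorphic.isCompact_glFiniteIntegralLevel 2 F), ∃ π : Literature.NumberTheory.Automorphic.CuspidalAutomorphicRepData 2 F hcpt, π.1.IsLAlgebraic ∧ ∀ᶠ w : IsDedekindDomain.HeightOneSpectrum (NumberField.RingOfIntegers F) in Filter.cofinite, ∃ α : Multiset ℂ, π.1.HasSatakeParamAt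 w α ∧ (α.map fun a => a⁻¹).sum = (Literature.NumberTheory.Automorphic.frobTraceAt E w : ℂ) ∧ (α.map fun a => a⁻¹).prod = (w.residueCard : ℂ)

-- earlier NonOrdinaryEisensteinModular (stmt-Langlands-15860, replaced 2026-08-16T17:12:31Z -> stmt-Langlands-16054): retired by None — ∀ (F : Type) [Field F] [NumberField F], NumberField.IsTotallyComplex F → Module.finrank ℚ F = 2 → ∀ (p : ℕ) [Fact p.Prime], p ≠ 2 → ∀ (W : WeierstrassCurve F) [W.IsElliptic], ¬ W.HasCM → ¬ W.HasIrreducibleModPGaloisRep p → ¬ (∀ v : IsDedekindDomain.HeightOneSpectrum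
/-- item stmt-Langlands-16054 · crux · rank 2 · open · by planner
why it might fail: TW primes cannot kill H¹(F,χ/χ') classes (local H¹ dies where ρ̄(Frob_q) has distinct eigenvalues): scalar-Frobenius primes AND CG patching at an Eisenstein 𝔪 (boundary classes, non-free complexes) are needed at once; no non-ordinary residually reducible lifting is in print off F_v = ℚ_p.
sources: Thorne2014, arXiv:1912.11269, arXiv:1606.06535, BergerKlosin2011, Pan2022, arXiv:2411.18661
[crux] THE NEW LEVER (from route-Langlands-SkinnerWilesDefectOne: its engine stops at ordinary; from
Berger–Klosin: the finiteness hypothesis made unconditional). CONE REPAIR rev 3 typing: F imaginary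
quadratic, p odd, E an integral Weierstrass model over 𝓞_F with Δ ≠ 0, no geometric CM, E[p]
REDUCIBLE (¬(E.baseChange F).HasIrreducibleModPGaloisRep p: an F-rational p-isogeny) and NOT nearly
ordinary of weight 2 at some v ∣ p — typed: there is NO an IRREDUCIBLE TATE FRAME of E at p — ρ :
Γ_F → GL₂(ℚ̄_p) (`FramedGaloisRep F (PadicAlgCl p) 2`) with ρ irreducible, unramified at almost
every w and Frobenius characteristic polynomial X² − a_w(E)X + N w at almost every w (these are
exactly the GL₂(ℚ̄_p)-conjugates of ρ_(E,p) = V_pE ⊗ ℚ̄_p: Hasse–Weil, Chebotarev + Brauer–Nesbitt,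
Serre–Faltings irreducibility for non-CM E) that is `IsOrdinaryOfWeightAt p v 2 m` (some m > 0) at
every v ∣ p; i.e. ρ_(E,p) is potentially supersingular at some v ∣ p (good supersingular at an inert
p, or additive potentially supersingular as the conductor-50 curves at p = 5) ⇒ E modular: for every
level witness hcpt an L-algebraic cuspidal π on GL₂(𝔸_F) with Σ_j α_j⁻¹ = a_w(E) = frobTraceAt E w
and Π_j α_j⁻¹ = -/
@[route_item "route-Langlands-FifteenLocusEisenstein", crux]
def NonOrdinaryEisensteinModular : Prop :=
  ∀ (F : Type) [Field F] [NumberField F], NumberField.IsTotallyComplex F → Module.finrank ℚ F = 2 → ∀ (p : ℕ) [Fact p.Prime], p ≠ 2 → ∀ (E : WeierstrassCurve (NumberField.RingOfIntegers F)), E.Δ ≠ 0 → ¬ (E.baseChange F).HasCM → ¬ (E.baseChange F).HasIrreducibleModPGaloisRep p → ¬ (∃ ρ : Literature.NumberTheory.GaloisRepresentations.FramedGaloisRep F (PadicAlgCl p) 2, (ρ.toGaloisRep.IsIrreducible ∧ ∀ᶠ w : IsDedekindDomain.HeightOneSpectrum (NumberField.RingOfIntegers F) in Filter.cofinite, ρ.IsUnramifiedAt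 w ∧ ρ.HasFrobCharpolyAt w (Polynomial.X ^ 2 - Polynomial.C ((Literature.NumberTheory.Automorphic.frobTraceAt E w : ℤ) : PadicAlgCl p) * Polynomial.X + Polynomial.C ((w.residueCard : ℕ) : PadicAlgCl p))) ∧ ∀ v : IsDedekindDomain.HeightOneSpectrum (NumberField.RingOfIntegers F), (p : NumberField.RingOfIntegers F) ∈ v.asIdeal → ∃ m : ℕ, 0 < m ∧ ρ.IsOrdinaryOfWeightAt p v 2 m) → ∀ (hcpt : Literature.NumberTheory.Automorphic.isCompact_glFiniteIntegralLevel 2 F), ∃ π : Literature.NumberTheory.Automorphic.CuspidalAutomorphicRepData 2 F hcpt, π.1.IsLAlgebraic ∧ ∀ᶠ w : IsDedekindDomain.HeightOneSpectrum (NumberField.RingOfIntegers F) in Filter.cofinite, ∃ α : Multiset ℂ, π.1.HasSatakeParamAt w α ∧ (α.map fun a => a⁻¹).sum = (Literature.NumberTheory.Automorphic.frobTraceAt E w : ℂ) ∧ (α.map fun a => a⁻¹).prod = (w.residueCard : ℂ)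

-- earlier UnorientedOrdinaryModular (stmt-Langlands-15861, replaced 2026-08-16T17:12:31Z -> stmt-Langlands-16055): retired by None — ∀ (F : Type) [Field F] [NumberField F], NumberField.IsTotallyComplex F → Module.finrank ℚ F = 2 → ∀ (p : ℕ) [Fact p.Prime], p ≠ 2 → ∀ (W : WeierstrassCurve F) [W.IsElliptic], ¬ W.HasCM → ¬ W.HasIrreducibleModPGaloisRep p → (∀ v : IsDedekindDomain.HeightOneSpectrum (Num
/-- item stmt-Langlands-16055 · crux · rank 3 · open · by planner
why it might fail: The mixed-oriented reducible pencil has dimension h¹_f of an anticyclotomic CM character (BSD-type, may exceed 1); near-ordinary automorphy of CM-type Eisenstein systems with the MIXED refinement in the Bianchi Hida/completed Hecke algebra is unrecorded (Harder gives classes, not refinements).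
sources: SkinnerWiles1999, CaraianiNewton2023, Thorne2014, arXiv:1606.06535, CalegariGeraghty2017, Weil1956
[crux] MIXED TYPE (from route-Langlands-SkinnerWilesDefectOne's FiveIsogenyEllipticCurves: 'the
mixed type at split 5 is outside Skinner–Wiles … deliberately excluded'; from
route-Langlands-IrreducibilityBySelfDuality's HalfIntegralTwistCM: CM-type characters exist). CONE
REPAIR rev 3 typing: F imaginary quadratic, p odd, E an integral Weierstrass model over 𝓞_F with Δ ≠
0, no geometric CM, E[p] reducible, nearly ordinary of weight 2 at EVERY v ∣ p (some an IRREDUCIBLE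
TATE FRAME of E at p — ρ : Γ_F → GL₂(ℚ̄_p) (`FramedGaloisRep F (PadicAlgCl p) 2`) with ρ
irreducible, unramified at almost every w and Frobenius characteristic polynomial X² − a_w(E)X + N w
at almost every w (these are exactly the GL₂(ℚ̄_p)-conjugates of ρ_(E,p) = V_pE ⊗ ℚ̄_p: Hasse–Weil,
Chebotarev + Brauer–Nesbitt, Serre–Faltings irreducibility for non-CM E) is `IsOrdinaryOfWeightAt p
v 2 m`, m > 0, at every v ∣ p), but admitting NO Skinner–Wiles datum (no irreducible Tate frame ρ
with residually upper-triangular integral model ρ₀ over the valuation ring of ℚ̄_p, p-distinguished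
and ORIENTED ordinary of weight 2 — ‖Q₀₀‖ ≤ ‖Q₁₀‖, lower-left of Q⁻¹ρ|D_vQ vanishes, θ₂^m = 1, θ₁^m
= ε^m on inertia — at every v ∣ p with -/
@[route_item "route-Langlands-FifteenLocusEisenstein", crux]
def UnorientedOrdinaryModular : Prop :=
  ∀ (F : Type) [Field F] [NumberField F], NumberField.IsTotallyComplex F → Module.finrank ℚ F = 2 → ∀ (p : ℕ) [Fact p.Prime], p ≠ 2 → ∀ (E : WeierstrassCurve (NumberField.RingOfIntegers F)), E.Δ ≠ 0 → ¬ (E.baseChange F).HasCM → ¬ (E.baseChange F).HasIrreducibleModPGaloisRep p → (∃ ρ : Literature.NumberTheory.GaloisRepresentations.FramedGaloisRep F (PadicAlgCl p) 2, (ρ.toGaloisRep.IsIrreducible ∧ ∀ᶠ w : IsDedekindDomain.HeightOneSpectrum (NumberField.RingOfIntegers F) in Filter.cofinite, ρ.IsUnramifiedAt w ∧ ρ.HasFrobCharpolyAt w (Polynomial.X ^ 2 - Polynomial.C ((Literature.NumberTheory.Automorphic.frobTraceAt E w : ℤ) : PadicAlgCl p) * Polynomial.X + Polynomial.C ((w.residueCard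 : ℕ) : PadicAlgCl p))) ∧ ∀ v : IsDedekindDomain.HeightOneSpectrum (NumberField.RingOfIntegers F), (p : NumberField.RingOfIntegers F) ∈ v.asIdeal → ∃ m : ℕ, 0 < m ∧ ρ.IsOrdinaryOfWeightAt p v 2 m) → ¬ (∃ (O : ValuationSubring (PadicAlgCl p)) (ρ : Literature.NumberTheory.GaloisRepresentations.FramedGaloisRep F (PadicAlgCl p) 2) (ρ₀ : Field.absoluteGaloisGroup F →* Matrix.GeneralLinearGroup (Fin 2) O), O = (Valued.v : Valuation (PadicAlgCl p) NNReal).valuationSubring ∧ (ρ.toGaloisRep.IsIrreducible ∧ ∀ᶠ w : IsDedekindDomain.HeightOneSpectrum (NumberField.RingOfIntegers F) in Filter.cofinite, ρ.IsUnramifiedAt w ∧ ρ.HasFrobCharpolyAt w (Polynomial.X ^ 2 - Polynomial.C ((Literature.NumberTheory.Automorphic.frobTraceAt E w : ℤ) : PadicAlgCl p) * Polynomial.X + Polynomial.C ((w.residueCard : ℕ) : PadicAlgCl p))) ∧ ρ.HasUpperTriangularIntegralModel ρ₀ ∧ ∃ m : ℕ, 0 < m ∧ ∀ v : IsDedekindDomain.HeightOneSpectrum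 (NumberField.RingOfIntegers F), (p : NumberField.RingOfIntegers F) ∈ v.asIdeal → Literature.NumberTheory.GaloisRepresentations.IsPDistinguishedAt ρ₀ v ∧ ∃ Q : Matrix.GeneralLinearGroup (Fin 2) (PadicAlgCl p), Valued.v (Q.val 0 0) ≤ Valued.v (Q.val 1 0) ∧ ∀ σ, (Q⁻¹ * ρ.toLocal v σ * Q).val 1 0 = 0 ∧ (σ ∈ Literature.NumberTheory.GaloisRepresentations.absInertia (v.adicCompletion F) → (Q⁻¹ * ρ.toLocal v σ * Q).val 1 1 ^ m = 1 ∧ (Q⁻¹ * ρ.toLocal v σ * Q).val 0 0 ^ m = algebraMap (Padic p) (PadicAlgCl p) (((Literature.NumberTheory.GaloisRepresentations.GaloisRep.cyclotomicCharacter (v.adicCompletion F) p σ).val : PadicInt p) : Padic p) ^ ((2 - 1) * m))) → ∀ (hcpt : Literature.NumberTheory.Automorphic.isCompact_glFiniteIntegralLevel 2 F), ∃ π : Literature.NumberTheory.Automorphic.CuspidalAutomorphicRepData 2 F hcpt, π.1.IsLAlgebraic ∧ ∀ᶠ w : IsDedekindDomain.HeightOneSpectrum (NumberField.RingOfIntegers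 F) in Filter.cofinite, ∃ α : Multiset ℂ, π.1.HasSatakeParamAt w α ∧ (α.map fun a => a⁻¹).sum = (Literature.NumberTheory.Automorphic.frobTraceAt E w : ℂ) ∧ (α.map fun a => a⁻¹).prod = (w.residueCard : ℂ)

/-- item stmt-Langlands-12918 · crux · rank 4 · open · by planner
why it might fail: = Fontaine–Mazur (B) in the residually reducible, p-distinguished, SW-oriented ordinary parallel-weight sector over imaginary quadratic F (defect one, no base change available); only BergerKlosin2011/Akers-type minimal cases proved; typing audited ×3 on the parent route.
sources: SkinnerWiles1999, BergerKlosin2011, CaraianiNewton2023, CalegariGeraghty2017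
[target] Thesis X above: Skinner–Wiles Theorem A over an imaginary quadratic F (IsTotallyComplex ∧
finrank ℚ F = 2), p ≠ 2, O pinned to the valuation ring of ℚ̄_p, ρ irreducible and a.e. unramified
with a residually upper-triangular integral model ρ₀ (`HasUpperTriangularIntegralModel`), one
parallel weight k ≥ 2 and exponent m ≥ 1 such that at every v ∣ p: `IsPDistinguishedAt ρ₀ v` and an
ORIENTED ordinary frame Q (‖Q₀₀‖ ≤ ‖Q₁₀‖; lower-left of Q⁻¹ρ|D_vQ vanishes; on inertia θ₂^m = 1,
θ₁^m = ε^{(k-1)m}, the clause of `isOrdinaryOfWeightAt_iff_padicAlgCl`) ⟹ ∃ L-algebraic cuspidal π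
with `SatakeFrobCompatibleAt ι π ρ v` for cofinitely many v. Sector of
`Summit.Langlands.GaloisToAutomorphic 2` (Satake form; ordinary ⇒ de Rham, no PstWeilDeligneData
touched). Non-vacuous: ρ = T₅(11a1)|Γ_F for F = ℚ(√-2) with the isogeny-adapted lattice meets every
hypothesis. -/
@[route_item "route-Langlands-FifteenLocusEisenstein", crux]
def ReducibleOrdinaryModular : Prop :=
  ∀ (F : Type) [Field F] [NumberField F], NumberField.IsTotallyComplex F → Module.finrank ℚ F = 2 → ∀ (p : ℕ) [Fact p.Prime], p ≠ 2 → ∀ (O : ValuationSubring (PadicAlgCl p)), O = (Valued.v : Valuation (PadicAlgCl p) NNReal).valuationSubring → ∀ (hcpt : Literature.NumberTheory.Automorphic.isCompact_glFiniteIntegralLevel 2 F) (ι : PadicAlgCl p ≃+* ℂ) (ρ : Literature.NumberTheory.GaloisRepresentations.FramedGaloisRep F (PadicAlgCl p) 2) (ρ₀ : Field.absoluteGaloisGroup F →* Matrix.GeneralLinearGroup (Fin 2) O), ρ.toGaloisRep.IsIrreducible → (∀ᶠ v in cofinite, ρ.IsUnramifiedAt v) → ρ.HasUpperTriangularIntegralModel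 ρ₀ → (∃ k : ℕ, 2 ≤ k ∧ ∃ m : ℕ, 0 < m ∧ ∀ v : IsDedekindDomain.HeightOneSpectrum (NumberField.RingOfIntegers F), (p : NumberField.RingOfIntegers F) ∈ v.asIdeal → Literature.NumberTheory.GaloisRepresentations.IsPDistinguishedAt ρ₀ v ∧ ∃ Q : Matrix.GeneralLinearGroup (Fin 2) (PadicAlgCl p), Valued.v (Q.val 0 0) ≤ Valued.v (Q.val 1 0) ∧ ∀ σ, (Q⁻¹ * ρ.toLocal v σ * Q).val 1 0 = 0 ∧ (σ ∈ Literature.NumberTheory.GaloisRepresentations.absInertia (v.adicCompletion F) → (Q⁻¹ * ρ.toLocal v σ * Q).val 1 1 ^ m = 1 ∧ (Q⁻¹ * ρ.toLocal v σ * Q).val 0 0 ^ m = algebraMap (Padic p) (PadicAlgCl p) (((Literature.NumberTheory.GaloisRepresentations.GaloisRep.cyclotomicCharacter (v.adicCompletion F) p σ).val : PadicInt p) : Padic p) ^ ((k - 1) * m))) → ∃ π : Literature.NumberTheory.Automorphic.CuspidalAutomorphicRepData 2 F hcpt, π.1.IsLAlgebraic ∧ ∀ᶠ v in cofinite, Summit.Langlands.SatakeFrobCompatibleAt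 ι π.1 ρ v

-- earlier OrientedOrdinaryOfEngine (stmt-Langlands-15862, replaced 2026-08-16T17:12:31Z -> stmt-Langlands-16056): retired by None — ReducibleOrdinaryModular → ∀ (F : Type) [Field F] [NumberField F], NumberField.IsTotallyComplex F → Module.finrank ℚ F = 2 → ∀ (p : ℕ) [Fact p.Prime], p ≠ 2 → ∀ (W : WeierstrassCurve F) [W.IsElliptic], ¬ W.HasCM → (∃ (O : ValuationSubring (PadicAlgCl p)) (ρ : Literature
/-- item stmt-Langlands-16056 · crux · rank 5 · open · by planner
why it might fail: Bookkeeping from the engine (irreducibility, a.e.-unramifiedness sit in the datum); residual risk: an L- /C-normalisation or charpoly-uniqueness slip between SatakeFrobCompatibleAt and Σα⁻¹ = a_w (the banked fiveIsogenyEllipticCurves_proof did this transport) — restatement, not falsity.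
sources: SkinnerWiles1999, CaraianiNewton2023, SilvermanAEC2009, Serre1972, BuzzardGeeLMS2014
[crux] ENGINE ⇒ ORIENTED CASE (generalises the banked corollary FiveIsogenyEllipticCurves of route
SkinnerWilesDefectOne from 'good ordinary, uniform type, p = 5' to every non-CM E admitting a
Skinner–Wiles datum at an odd p). CONE REPAIR rev 3 typing: given ReducibleOrdinaryModular, for F
imaginary quadratic, p ≠ 2, E an integral Weierstrass model over 𝓞_F with Δ ≠ 0 and no geometric CM
that admits an IRREDUCIBLE TATE FRAME of E at p — ρ : Γ_F → GL₂(ℚ̄_p) (`FramedGaloisRep F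
(PadicAlgCl p) 2`) with ρ irreducible, unramified at almost every w and Frobenius characteristic
polynomial X² − a_w(E)X + N w at almost every w (these are exactly the GL₂(ℚ̄_p)-conjugates of
ρ_(E,p) = V_pE ⊗ ℚ̄_p: Hasse–Weil, Chebotarev + Brauer–Nesbitt, Serre–Faltings irreducibility for
non-CM E) together with a residually upper-triangular integral model ρ₀ over the valuation ring O of
ℚ̄_p, p-distinguished and oriented ordinary of weight 2 (‖Q₀₀‖ ≤ ‖Q₁₀‖; θ₂^m = 1, θ₁^m = ε^m on
inertia; one common m > 0) at every v ∣ p — the engine's own local clause with k = 2 — E is modular: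
for every level witness hcpt an L-algebraic cuspidal π on GL₂(𝔸_F) with Σ_j α_j⁻¹ = a_w(E) =
frobTraceAt E w and Π_j α_j⁻¹ = N w at -/
@[route_item "route-Langlands-FifteenLocusEisenstein", crux]
def OrientedOrdinaryOfEngine : Prop :=
  ReducibleOrdinaryModular → ∀ (F : Type) [Field F] [NumberField F], NumberField.IsTotallyComplex F → Module.finrank ℚ F = 2 → ∀ (p : ℕ) [Fact p.Prime], p ≠ 2 → ∀ (E : WeierstrassCurve (NumberField.RingOfIntegers F)), E.Δ ≠ 0 → ¬ (E.baseChange F).HasCM → (∃ (O : ValuationSubring (PadicAlgCl p)) (ρ : Literature.NumberTheory.GaloisRepresentations.FramedGaloisRep F (PadicAlgCl p) 2) (ρ₀ : Field.absoluteGaloisGroup F →* Matrix.GeneralLinearGroup (Fin 2) O), O = (Valued.v : Valuation (PadicAlgCl p) NNReal).valuationSubring ∧ (ρ.toGaloisRep.IsIrreducible ∧ ∀ᶠ w : IsDedekindDomain.HeightOneSpectrum (NumberField.RingOfIntegers F) in Filter.cofinite, ρ.IsUnramifiedAt w ∧ ρ.HasFrobCharpolyAt w (Polynomial.X ^ 2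 - Polynomial.C ((Literature.NumberTheory.Automorphic.frobTraceAt E w : ℤ) : PadicAlgCl p) * Polynomial.X + Polynomial.C ((w.residueCard : ℕ) : PadicAlgCl p))) ∧ ρ.HasUpperTriangularIntegralModel ρ₀ ∧ ∃ m : ℕ, 0 < m ∧ ∀ v : IsDedekindDomain.HeightOneSpectrum (NumberField.RingOfIntegers F), (p : NumberField.RingOfIntegers F) ∈ v.asIdeal → Literature.NumberTheory.GaloisRepresentations.IsPDistinguishedAt ρ₀ v ∧ ∃ Q : Matrix.GeneralLinearGroup (Fin 2) (PadicAlgCl p), Valued.v (Q.val 0 0) ≤ Valued.v (Q.val 1 0) ∧ ∀ σ, (Q⁻¹ * ρ.toLocal v σ * Q).val 1 0 = 0 ∧ (σ ∈ Literature.NumberTheory.GaloisRepresentations.absInertia (v.adicCompletion F) → (Q⁻¹ * ρ.toLocal v σ * Q).val 1 1 ^ m = 1 ∧ (Q⁻¹ * ρ.toLocal v σ * Q).val 0 0 ^ m = algebraMap (Padic p) (PadicAlgCl p) (((Literature.NumberTheory.GaloisRepresentations.GaloisRep.cyclotomicCharacter (v.adicCompletion F) p σ).val : PadicInt p) : Padic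 p) ^ ((2 - 1) * m))) → ∀ (hcpt : Literature.NumberTheory.Automorphic.isCompact_glFiniteIntegralLevel 2 F), ∃ π : Literature.NumberTheory.Automorphic.CuspidalAutomorphicRepData 2 F hcpt, π.1.IsLAlgebraic ∧ ∀ᶠ w : IsDedekindDomain.HeightOneSpectrum (NumberField.RingOfIntegers F) in Filter.cofinite, ∃ α : Multiset ℂ, π.1.HasSatakeParamAt w α ∧ (α.map fun a => a⁻¹).sum = (Literature.NumberTheory.Automorphic.frobTraceAt E w : ℂ) ∧ (α.map fun a => a⁻¹).prod = (w.residueCard : ℂ)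

-- earlier IrreducibleFiveModular (stmt-Langlands-15863, replaced 2026-08-16T17:12:31Z -> stmt-Langlands-16057): retired by None — ∀ (F : Type) [Field F] [NumberField F], NumberField.IsTotallyComplex F → Module.finrank ℚ F = 2 → ∀ (W : WeierstrassCurve F) [W.IsElliptic], ¬ W.HasCM → W.HasIrreducibleModPGaloisRep 5 → ∀ (hcpt : Literature.NumberTheory.Automorphic.isCompact_glFiniteIntegralLevel 2 F) (ℓ
/-- item stmt-Langlands-16057 · crux · rank 6 · open · by planner
why it might fail: Formalization debt, not mathematics: printed CaraianiNewton2023 Thm 7.1(1) (+ Lemma 6.1.3: r_ι(π) ≅ r_(E,p)^∨); false as typed only by a normalisation slip in the point-count clause (same Σα⁻¹ = a_w, Πα⁻¹ = N w convention as the PROVED FiveIsogenyEllipticCurves).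
sources: CaraianiNewton2023, AllenKhareThorne2021WeightOne, ACCGHLNSTT2023
[crux] INPUT — Caraiani–Newton 2023, Theorem 7.1(1) (with Lemma 6.1.3(2)). CONE REPAIR rev 3 typing:
F imaginary quadratic, E an integral Weierstrass model over 𝓞_F with Δ ≠ 0, no geometric CM, Γ_F
acting irreducibly on E[5] (`(E.baseChange F).HasIrreducibleModPGaloisRep 5`) ⇒ E modular: for every
level witness hcpt an L-algebraic cuspidal π on GL₂(𝔸_F) with Σ_j α_j⁻¹ = a_w(E) = frobTraceAt E w
and Π_j α_j⁻¹ = N w at almost every w (point-count form, L-normalisation; verbatim the conclusion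
shape of the PROVED SkinnerWilesDefectOne.FiveIsogenyEllipticCurves). Printed theorem (3–5 switching
over CM fields + crystalline torsion local–global compatibility + quadratic points on X(ns3°,b5),
X(b3,ns5), X(s3,ns5), X(ns3°,ns5)); formalization debt, filed as a crux so that `closes` assumes
cruxes only; the point-count conclusion follows from CN's r_ι(π) ≅ r_(E,p)^∨ by Hasse–Weil (tree,
proved). [difficulty: XL] -/
@[route_item "route-Langlands-FifteenLocusEisenstein", crux]
def IrreducibleFiveModular : Prop :=
  ∀ (F : Type) [Field F] [NumberField F], NumberField.IsTotallyComplex F → Module.finrank ℚ F = 2 → ∀ (E : WeierstrassCurve (NumberField.RingOfIntegers F)), E.Δ ≠ 0 → ¬ (E.baseChange F).HasCM → (E.baseChange F).HasIrreducibleModPGaloisRep 5 → ∀ (hcpt : Literature.NumberTheory.Automorphic.isCompact_glFiniteIntegralLevel 2 F), ∃ π : Literature.NumberTheory.Automorphic.CuspidalAutomorphicRepData 2 F hcpt, π.1.IsLAlgebraic ∧ ∀ᶠ w : IsDedekindDomain.HeightOneSpectrum (NumberField.RingOfIntegers F) in Filter.cofinite, ∃ α : Multiset ℂ, π.1.HasSatakeParamAt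 w α ∧ (α.map fun a => a⁻¹).sum = (Literature.NumberTheory.Automorphic.frobTraceAt E w : ℂ) ∧ (α.map fun a => a⁻¹).prod = (w.residueCard : ℂ)

/-- item stmt-Langlands-19093 · crux · rank 7 · open · by planner
why it might fail: Formalization debt, not mathematics (JS II Prop. 3.6 / AC (2.3) is a theorem): false AS TYPED only by a normalisation slip in the inlined text (q_w^(1−s₀) vs q_w^(s₀−1), unitary normalisation, α vs β⁻¹); ranks ≤ 2 of this exact text are proved in tree; ranks ≥ 3 hang on an XL archimedean leaf.
sources: JacquetShalikaAJM1981II, ArthurClozelAMS120, JacquetShalikaAJM1981, ShahidiAJM1981, HumphriesJo2024, CogdellAnalyticTheory2004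
[crux] ARTHUR–CLOZEL (2.3) FOR BOREL–JACQUET DATA — PROMOTED LITERATURE INPUT of the junction's line
(route-choice 2026-08-17, unit rchoice-Summits-Langlands-Langlands-Cr-16a26670: the birth skeleton
Cruxes/SectorComplement/Lines/birth.lean of SectorComplement (stmt-Langlands-14623) consumed the
named fact Literature.NumberTheory.Automorphic.JacquetShalika1981_partialPairL_pole_repData as its
stub stub_pairLPoleJS; that fact is judged XL-apex — too large for one prover seat, and non-crux
Literature facts are not split — so it is promoted to an explicit crux of this route and the line is
rewired to this decl BY NAME). STATEMENT (Jacquet–Shalika II Prop. 3.6 = Arthur–Clozel Ch. 3 §2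
(2.3), p. 171, in the Borel–Jacquet model): for cuspidal π, π′ on GL_n(𝔸_F) (n ≥ 1, data
CuspidalAutomorphicRepData, arbitrary central characters) there is a finite S₀ such that for every
finite S ⊇ S₀, all Satake families α, β of π, π′ off S in unitary normalisation (‖∏α_w‖ = ‖∏β_w‖ =
1) and every s₀ on Re s = 1 IN X (q_w^(1−s₀)·α_w = β_w⁻¹ as multisets for almost all w: the
Hecke-matrix form of π ⊗ |·|^(s₀−1) ≅ σ̃), the limit of (s − s₀)·L^S(s, α × β) as s → s₀ with Re s >
1 exists and is NON-ZERO, wher -/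
@[route_item "route-Langlands-FifteenLocusEisenstein"]
def PairLPoleJS : Prop :=
  ∀ (n : ℕ) (F : Type) [Field F] [NumberField F] (hF : Literature.NumberTheory.Automorphic.isCompact_glFiniteIntegralLevel n F), 0 < n → ∀ (π π' : Literature.NumberTheory.Automorphic.CuspidalAutomorphicRepData n F hF), ∃ S₀ : Set (IsDedekindDomain.HeightOneSpectrum (NumberField.RingOfIntegers F)), S₀.Finite ∧ ∀ {S : Set (IsDedekindDomain.HeightOneSpectrum (NumberField.RingOfIntegers F))}, S.Finite → S₀ ⊆ S → ∀ {α β : IsDedekindDomain.HeightOneSpectrum (NumberField.RingOfIntegers F) → Multiset ℂ}, (∀ w ∉ S, π.1.HasSatakeParamAt w (α w)) → (∀ w ∉ S, π'.1.HasSatakeParamAt w (β w)) → (∀ w ∉ S, ‖(α w).prod‖ = 1) → (∀ w ∉ S, ‖(β w).prod‖ = 1) → ∀ {s₀ : ℂ}, s₀.re = 1 → (∀ᶠ w in cofinite, (α w).map ((((w.residueCard : ℂ) ^ (1 - s₀))) * ·) = (β w).map (·⁻¹)) → ∃ c : ℂ, c ≠ 0 ∧ Tendsto (fun s : ℂ =>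 (s - s₀) * ∏' w : {w : IsDedekindDomain.HeightOneSpectrum (NumberField.RingOfIntegers F) // w ∉ S}, ((Literature.NumberTheory.Automorphic.satakePairPolynomial (α w.1) (β w.1)).eval ((w.1.residueCard : ℂ) ^ (-s)))⁻¹) (𝓝[{s : ℂ | 1 < s.re}] s₀) (𝓝 c)

/-- item stmt-Langlands-13622 · crux · rank 8 · SPLIT (gen 1) into ArchEqualRankTestVector, ArchGapEntireRatio + glue PairLBoundaryJS_of_archSubs · direct attempts still welcome (low priority) · by planner
why it might fail: Formalization debt, not mathematics (JS II Prop. 3.6 off X + Shahidi = AC (2.2), a theorem): false AS TYPED only by a normalisation slip in the inlined text (q_w^(1−s₀) vs q_w^(s₀−1), unitary normalisation, X = (n = m ∧ α·q^(1−s₀) = β⁻¹ a.e.)); (1,1) proved in tree.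
sources: JacquetShalikaAJM1981II, ArthurClozelAMS120, JacquetShalikaAJM1981, ShahidiAJM1981, MoeglinWaldspurger1989
[support] INPUT — Jacquet–Shalika 1981 / Arthur–Clozel Ch. 3 (2.2) for cuspidal Borel–Jacquet data
on GL_n × GL_m: off the X-condition (n = m and, a.e., β_w⁻¹ = q_w^{1−s₀}·α_w as multisets), assuming
unitary central characters a.e. (‖∏ α_w‖ = ‖∏ β_w‖ = 1), the partial Rankin–Selberg product L^S(s, α
× β) = ∏'_{w ∉ S} ∏_{a,b} (1 − a b q_w^{−s})⁻¹ has a finite NON-ZERO limit at Re s₀ = 1 from Re s >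
1. SAME TEXT as
`Literature.NumberTheory.Automorphic.JacquetShalika1981_partialPairL_boundary_repData` with
`partialPairL S α β` unfolded to its defining `tprod` over `satakePairPolynomial`
(RankinSelbergLocal, in the Statement's closure) and `SatakeFamily F` unfolded to `HeightOneSpectrum
(𝓞 F) → Multiset ℂ` — definitionally equal (delta/eta), closes by `exact`/`simpa [partialPairL]` the
day the fact's `_holds` lands (it is reduced in tree to its L² leaves). CONE REPAIR 2026-08-15
(route-repair planner): no import of PairLFunctionPolesRepData (whose closure carried 383 modules /
~45 unproved facts into the cone). Rank 1 (renders before IrreducibleGL3CM). [difficulty: L] -/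
@[route_item "route-Langlands-FifteenLocusEisenstein"]
def PairLBoundaryJS : Prop :=
  ∀ (n m : ℕ) (F : Type) [Field F] [NumberField F] (hF : _) (hF' : _), 0 < n → 0 < m → ∀ (π : Literature.NumberTheory.Automorphic.CuspidalAutomorphicRepData n F hF) (π' : Literature.NumberTheory.Automorphic.CuspidalAutomorphicRepData m F hF'), ∃ S₀ : Set (IsDedekindDomain.HeightOneSpectrum (NumberField.RingOfIntegers F)), S₀.Finite ∧ ∀ {S : Set (IsDedekindDomain.HeightOneSpectrum (NumberField.RingOfIntegers F))}, S.Finite → S₀ ⊆ S → ∀ {α β : IsDedekindDomain.HeightOneSpectrum (NumberField.RingOfIntegers F) → Multiset ℂ}, (∀ w ∉ S, π.1.HasSatakeParamAt w (α w)) → (∀ w ∉ S, π'.1.HasSatakeParamAt w (β w)) → (∀ w ∉ S, ‖(α w).prod‖ = 1) → (∀ w ∉ S, ‖(β w).prod‖ = 1) → ∀ {s₀ : ℂ}, s₀.re = 1 → ¬ (n = m ∧ ∀ᶠ w in cofinite, (α w).map ((((w.residueCard : ℂ) ^ (1 - s₀))) * ·) = (β w).map (·⁻¹)) → ∃ c :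 ℂ, c ≠ 0 ∧ Tendsto (fun s : ℂ => ∏' w : {w : IsDedekindDomain.HeightOneSpectrum (NumberField.RingOfIntegers F) // w ∉ S}, ((Literature.NumberTheory.Automorphic.satakePairPolynomial (α w.1) (β w.1)).eval ((w.1.residueCard : ℂ) ^ (-s)))⁻¹) (𝓝[{s : ℂ | 1 < s.re}] s₀) (𝓝 c)

-- parent: PairLBoundaryJS · child (gen 1)
/--     item stmt-Langlands-18107 · crux · rank 801 · open
    parent: PairLBoundaryJS · by operator
    why it might fail: Theorem in print (HJ 2024 Thm 1.1/5.6; Jacquet 2009 Thm 2.7 for the consumed weakening); false AS TYPED only by a rendering slip: product group GL_n(K_∞) vs one field (Fubini over w|∞), the c^s normalisation, clause (ii) for ALL K-finite poly-Gaussian data on Re s>1 (exponent bound JS81 Cor 2.5).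
    sources: HumphriesJo2024, JacquetArchimedeanRS2009, JacquetShalikaAJM1981, CogdellAnalyticTheory2004
[crux] ARCHIMEDEAN SPLIT of PairLBoundaryJS (crux-strategist s2, 2026-08-17), child 1 of 2 — the
EQUAL-RANK archimedean Rankin–Selberg test vector (Humphries–Jo 2024 Thm 1.1 / Thm 5.6 with Prop
5.2, plus Jacquet–Shalika's archimedean absolute convergence on Re s > 1 for K_∞-finite data): for
irreducible unitary τ, τ' of GL_n(K_∞) with non-zero continuous Whittaker functionals, (i) ONE
K_∞-finite Gårding datum (e, e', Φ_∞ polynomial × Gaussian) with Ψ_∞(s; W_e, W̄'_{e'}, Φ_∞) = c^s ∏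
Γ_ℝ(s+a_j) ∏ Γ_ℂ(s+b_j) on Re s > 1 (re a_j, re b_j > -1), (ii) integrability of every K_∞-finite
poly-Gaussian datum on Re s > 1. VERBATIM the named fact
`HumphriesJo2024_archRankinSelberg_testVector n K`, universally closed over n and K (rank 1 PROVED
in tree: `HumphriesJo2024_archRankinSelberg_testVector_one`, Tate; n = 0 is trivially true —
constant integrand, take Φ_∞ constant, c = 1, no shifts). It is the lead's open stub
`stub_humphriesJo` of line Sketch (leaves hB = MW (i)(b) orthogonal form and hC = MW (ii), through
the LANDED `PairLBoundaryJSOfHumphriesJo` / `LocalPairTranslate` /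
`archPairLFactorData_of_testVector`). What the parent actually CONSUMES is weaker — one K_∞-finite
datum whose Σ_i -/
@[route_item "route-Langlands-FifteenLocusEisenstein"]
def ArchEqualRankTestVector : Prop :=
  ∀ (n : ℕ) (K : Type) [Field K] [NumberField K], Literature.NumberTheory.Automorphic.HumphriesJo2024_archRankinSelberg_testVector n K

-- parent: PairLBoundaryJS · child (gen 1)
/--     item stmt-Langlands-18108 · crux · rank 802 · open
    parent: PairLBoundaryJS · by operator
    why it might fail: Theorem in print (Jacquet 2009 Thm 2.1/2.6 + Prop 12.5, K-finite finite-sum form by density + Shalika uniqueness over K_∞ = ∏ K_w); false AS TYPED only by a rendering slip: weak (Langlands) ordering of exponents in Thm 2.6 (i), the shift s+(n−m)/2 absorbed in a_j,b_j, product-group reduction.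
    sources: JacquetArchimedeanRS2009, JacquetShalikaArchimedean1990, CogdellAnalyticTheory2004, Shalika1974
[crux] ARCHIMEDEAN SPLIT of PairLBoundaryJS (crux-strategist s2, 2026-08-17), child 2 of 2 —
archimedean K_∞-finite ENTIRE-RATIO control for the GL_n × GL_m Rankin–Selberg integral, m < n
(Jacquet 2009 Thm 2.1 (i)(ii), Thm 2.6 (i), Prop 12.5 (ii)/§12.3; Jacquet–Shalika 1990; Cogdell 2004
Thm 3.5 and §4.2): for irreducible unitary τ of GL_n(K_∞), τ' of GL_m(K_∞) with non-zero continuous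
Whittaker functionals and every s₀ ∈ ℂ, finitely many K_∞-finite Gårding data with Σ_i
Ψ^{(n,m)}_∞(s; e_i, e'_i) = h(s) c^s ∏ Γ_ℝ(s+a_j) ∏ Γ_ℂ(s+b_j) on a right half-plane, h ENTIRE with
h(s₀) ≠ 0; plus absolute convergence for re s large. VERBATIM the named fact
`JacquetShalika1990_archRankinSelbergGap_entireRatio n m K`, universally closed (vacuous unless m <
n — the fact's first binder is `m < n`; m = 0 trivially true: constant integrand, h = const ≠ 0). It
is the lead's open stub `stub_gap_arch_fact` of line Sketch (leaf hA = MW (i)(a) for every m < n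
through the LANDED gap road: GapArchFactorData, GapLocalControlAsm,
PairLBoundaryJSOfArchFacts.partialPairL_entire_of_rank_ne_of_archGap; the corner n = m+1 included,
GapArchFactSucc). Two roads close it: (A) the printed archimedean theory (Jacquet -/
@[route_item "route-Langlands-FifteenLocusEisenstein"]
def ArchGapEntireRatio : Prop :=
  ∀ (n m : ℕ) (K : Type) [Field K] [NumberField K], Literature.NumberTheory.Automorphic.JacquetShalika1990_archRankinSelbergGap_entireRatio n m K

-- parent: PairLBoundaryJS · glue (gen 1)
/--     item stmt-Langlands-18109 · support · rank 803 · open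
    parent: PairLBoundaryJS · GLUE: children ⟹ parent · by operator
ARCHIMEDEAN SPLIT glue (crux-strategist s2): ArchEqualRankTestVector → ArchGapEntireRatio →
PairLBoundaryJS. PROVED modulo farm build: it is
PairLBoundaryJSOfArchFacts.stub_PairLBoundaryJS_of_three_facts (landed p141340: crux ⇐ HJ + JS-gap +
Cogdell analytic clause) with the third input discharged by
GapEntireFactHolds.Cogdell2004_unfoldedPairIntegral_entire_holds (landed p141917); candidate file
Split.lean attached as evidence on stmt-Langlands-13622 (3-line proof; lands as
Theorems/…PairLBoundaryJSArchSplit.lean --supports the glue item once the farm has built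
GapEntireFactHolds). -/
@[route_item "route-Langlands-FifteenLocusEisenstein"]
def PairLBoundaryJS_of_archSubs : Prop :=
  ArchEqualRankTestVector → ArchGapEntireRatio → PairLBoundaryJS

-- earlier SectorComplement (stmt-Langlands-15882, replaced 2026-08-16T17:12:31Z -> stmt-Langlands-16058): retired by None — (∀ (F : Type) [Field F] [NumberField F], NumberField.IsTotallyComplex F → Module.finrank ℚ F = 2 → ∀ (W : WeierstrassCurve F) [W.IsElliptic], ¬ W.HasCM → ∀ (hcpt : Literature.NumberTheory.Automorphic.isCompact_glFiniteIntegralLevel 2 F) (ℓ : ℕ) [Fact ℓ.Prime] (ι : PadicAlgCl ℓ 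
-- earlier SectorComplement (stmt-Langlands-2175, replaced 2026-08-16T16:51:00Z -> stmt-Langlands-15882): open — Target → _root_.Langlands
/-- item stmt-Langlands-16058 · crux · rank 9 · open · by planner
why it might fail: It IS the open reciprocity conjecture for GL_n outside one sector (BuzzardGeeLMS2014 Conj. 3.2.1/3.2.2, FontaineMazurGeometric1995 Conj. 1); no engine claimed; implied by the summit. Target text inlined so the item is self-contained.
sources: BuzzardGeeLMS2014, FontaineMazurGeometric1995, Calegari2023
[crux] THE REST OF THE MOUNTAIN — `Target → Langlands` with the (retyped, rev 3) Target text INLINED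
verbatim: every n ≠ 2, every F not imaginary quadratic, direction (A), CM curves, weights other than
(0,1), local–global compatibility at every place, 𝓡 — the honestly-labelled residual of this sector
route (summit-strength modulo Target; the summit implies Target through the tree's proved Hasse–Weil
Euler factors; closes only with the summit; not where this route directs provers; a crux so that
every hypothesis of `closes` is a declared crux). [difficulty: open-problem] -/
@[route_item "route-Langlands-FifteenLocusEisenstein", crux]
def SectorComplement : Prop :=
  (∀ (F : Type) [Field F] [NumberField F], NumberField.IsTotallyComplex F → Module.finrank ℚ F = 2 → ∀ (E : WeierstrassCurve (NumberField.RingOfIntegers F)), E.Δ ≠ 0 → ¬ (E.baseChange F).HasCM → ∀ (hcpt : Literature.NumberTheory.Automorphic.isCompact_glFiniteIntegralLevel 2 F), ∃ π : Literature.NumberTheory.Automorphic.CuspidalAutomorphicRepData 2 F hcpt, π.1.IsLAlgebraic ∧ ∀ᶠ w : IsDedekindDomain.HeightOneSpectrum (NumberField.RingOfIntegers F) in Filter.cofinite, ∃ α : Multiset ℂ, π.1.HasSatakeParamAt w α ∧ (α.map fun a => a⁻¹).sum = (Literature.NumberTheory.Automorphic.frobTraceAt E w : ℂ) ∧ (α.map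 fun a => a⁻¹).prod = (w.residueCard : ℂ)) → _root_.Langlands

/-- item stmt-Langlands-15890 · support · rank 9 · closed · proved by Summit.Langlands.Langlands.Theorems.FifteenLocusEisensteinTargetOfCruxes.targetOfCruxes (prover) · by planner
sources: CaraianiNewton2023, SkinnerWiles1999, planner Sketch.lean (closes, lean check rc 0)
[support] GLUE TO THE TARGET (documentary; provable NOW by pure logic, the body of `closes` without
its last step): fix F, W, hcpt, ℓ, ι; by_cases on `W.HasIrreducibleModPGaloisRep 5`
(IrreducibleFiveModular), else on near-ordinarity of weight 2 at every v ∣ 5 (its negation feeds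
NonOrdinaryEisensteinModular at p = 5), else on the Skinner–Wiles datum (OrientedOrdinaryOfEngine
fed with ReducibleOrdinaryModular, resp. UnorientedOrdinaryModular). Filed so that an item concludes
`Target` by name; `closes` = this ∘ SectorComplement. -/
@[route_item "route-Langlands-FifteenLocusEisenstein"]
def TargetOfCruxes : Prop :=
  IrreducibleFiveModular → NonOrdinaryEisensteinModular → UnorientedOrdinaryModular → ReducibleOrdinaryModular → OrientedOrdinaryOfEngine → Target

-- `TargetOfCruxes` holds: proved by `Summit.Langlands.Langlands.Theorems.FifteenLocusEisensteinTargetOfCruxes.targetOfCruxes` (its module imports this route file, so no `_holds` link can be stated here).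

/-- item stmt-Langlands-15864 · assembly · rank 1 · closed · proved by Summit.Langlands.Langlands.Theorems.fifteenLocusEisenstein_assembly_proof (prover) · by planner
sources: CaraianiNewton2023, SkinnerWiles1999
[assembly] IrreducibleFiveModular → NonOrdinaryEisensteinModular → UnorientedOrdinaryModular →
ReducibleOrdinaryModular → OrientedOrdinaryOfEngine → SectorComplement → Langlands (the type of
`closes`). -/
@[route_item "route-Langlands-FifteenLocusEisenstein"]
def Assembly : Prop :=
  IrreducibleFiveModular → NonOrdinaryEisensteinModular → UnorientedOrdinaryModular → ReducibleOrdinaryModular → OrientedOrdinaryOfEngine → SectorComplement → _root_.Langlands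

-- `Assembly` holds: proved by `Summit.Langlands.Langlands.Theorems.fifteenLocusEisenstein_assembly_proof` (its module imports this route file, so no `_holds` link can be stated here).

/-! D-0027 §2.1 — DECIDING THEOREM (planner-authored via `route open/edit --closes-file`; by planner-rrepair-Langlands-FifteenLocusEisenste-f01edbd6-0 2026-08-16T17:12:31Z):
its hypotheses are this route's items and its conclusion the sub-problem Statement (glue_lint), and it elaborates with this file. -/

@[closes "route-Langlands-FifteenLocusEisenstein"] theorem closes (h1 : IrreducibleFiveModular) (h3 : NonOrdinaryEisensteinModular)
    (h2 : UnorientedOrdinaryModular) (hE : ReducibleOrdinaryModular)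
    (h4 : OrientedOrdinaryOfEngine) (hS : SectorComplement) : _root_.Langlands := by
  refine hS ?_
  intro F _ _ htc hdeg E hΔ hcm hcpt
  haveI h5 : Fact (Nat.Prime 5) := ⟨by norm_num⟩
  by_cases hirr : (E.baseChange F).HasIrreducibleModPGaloisRep 5
  · exact h1 F htc hdeg E hΔ hcm hirr hcpt
  · by_cases hA : (∃ ρ : Literature.NumberTheory.GaloisRepresentations.FramedGaloisRep F (PadicAlgCl 5) 2, (ρ.toGaloisRep.IsIrreducible ∧ ∀ᶠ w : IsDedekindDomain.HeightOneSpectrum (NumberField.RingOfIntegers F) in Filter.cofinite, ρ.IsUnramifiedAt w ∧ ρ.HasFrobCharpolyAt w (Polynomial.X ^ 2 - Polynomial.C ((Literature.NumberTheory.Automorphic.frobTraceAt E w : ℤ) : PadicAlgCl 5) * Polynomial.X + Polynomial.C ((w.residueCard : ℕ) : PadicAlgCl 5))) ∧ ∀ v : IsDedekindDomain.HeightOneSpectrum (NumberField.RingOfIntegers F), ((5 : ℕ) : NumberField.RingOfIntegers F) ∈ v.asIdeal → ∃ m : ℕ, 0 < m ∧ ρ.IsOrdinaryOfWeightAt 5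 v 2 m)
    · by_cases hB : (∃ (O : ValuationSubring (PadicAlgCl 5)) (ρ : Literature.NumberTheory.GaloisRepresentations.FramedGaloisRep F (PadicAlgCl 5) 2) (ρ₀ : Field.absoluteGaloisGroup F →* Matrix.GeneralLinearGroup (Fin 2) O), O = (Valued.v : Valuation (PadicAlgCl 5) NNReal).valuationSubring ∧ (ρ.toGaloisRep.IsIrreducible ∧ ∀ᶠ w : IsDedekindDomain.HeightOneSpectrum (NumberField.RingOfIntegers F) in Filter.cofinite, ρ.IsUnramifiedAt w ∧ ρ.HasFrobCharpolyAt w (Polynomial.X ^ 2 - Polynomial.C ((Literature.NumberTheory.Automorphic.frobTraceAt E w : ℤ) : PadicAlgCl 5) * Polynomial.X + Polynomial.C ((w.residueCard : ℕ) : PadicAlgCl 5))) ∧ ρ.HasUpperTriangularIntegralModel ρ₀ ∧ ∃ m : ℕ, 0 < m ∧ ∀ v : IsDedekindDomain.HeightOneSpectrum (NumberField.RingOfIntegers F), ((5 : ℕ) : NumberField.RingOfIntegers F) ∈ v.asIdeal → Literature.NumberTheory.GaloisRepresentations.IsPDistinguishedAt ρ₀ v ∧ ∃ Q : Matrix.GeneralLinearGroup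 (Fin 2) (PadicAlgCl 5), Valued.v (Q.val 0 0) ≤ Valued.v (Q.val 1 0) ∧ ∀ σ, (Q⁻¹ * ρ.toLocal v σ * Q).val 1 0 = 0 ∧ (σ ∈ Literature.NumberTheory.GaloisRepresentations.absInertia (v.adicCompletion F) → (Q⁻¹ * ρ.toLocal v σ * Q).val 1 1 ^ m = 1 ∧ (Q⁻¹ * ρ.toLocal v σ * Q).val 0 0 ^ m = algebraMap (Padic 5) (PadicAlgCl 5) (((Literature.NumberTheory.GaloisRepresentations.GaloisRep.cyclotomicCharacter (v.adicCompletion F) 5 σ).val : PadicInt 5) : Padic 5) ^ ((2 - 1) * m)))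
      · exact h4 hE F htc hdeg 5 (by norm_num) E hΔ hcm hB hcpt
      · exact h2 F htc hdeg 5 (by norm_num) E hΔ hcm hirr hA hB hcpt
    · exact h3 F htc hdeg 5 (by norm_num) E hΔ hcm hirr hA hcpt

end Summit.Langlands.Langlands.Theses.FifteenLocusEisenstein
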